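import Mathlib

/-!
# A rank-free Erdős–Rado bound for the layers of a zero-sum-free sequence (solo-blind, door I1⁗ / (K₃), s80)

Let `h : ι → G` be a sequence in an abelian group of exponent `3` (`g + g + g = 0`), zero-sum free on the
index set `S` (no non-empty `T ⊆ S` has `∑_{i ∈ T} h i = 0`).  For `τ : G` and `k : ℕ` let
`N_k(τ) = #{T ⊆ S : |T| = k, ∑_{i ∈ T} h i = τ}` be the number of size-`k` representations of `τ`.

THEOREM (all ranks, all lengths, all `k`):  `N_k(τ) ≤ 2^k · k!`.

Proof (Erdős–Rado for the `3`-sunflower-free family of representations, run directly on the zero-sum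
structure): three pairwise disjoint representations of `τ` would unite to a non-empty zero-sum
(`τ + τ + τ = 0`), so a maximal disjoint subfamily has at most two members; their union `U`
(`|U| ≤ 2k`) meets every representation, and the representations through a fixed index `u` inject
(`T ↦ T ∖ {u}`) into the size-`(k-1)` representations of `τ - h u` by the zero-sum-free sequence on
`S ∖ {u}`.  Hence `N_k ≤ 2k · sup N_{k-1}` and the bound follows by induction.  This is the first layer
bound in the kernel that is uniform in the rank; the conjectured truth is `N_k ≤ 2^k` (proved for `k ≤ 4`
by complete censuses).
-/

namespace Summit.MatrixMultiplication.MatrixMultiplication.Theorems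

open Finset

variable {ι G : Type*} [DecidableEq ι] [AddCommGroup G] [DecidableEq G]

/-- The size-`k` representations of `τ` by the sequence `h` on the index set `S`:
the `k`-subsets `T ⊆ S` with `∑_{i ∈ T} h i = τ`. -/
def soloBlindSeqRep (h : ι → G) (S : Finset ι) (k : ℕ) (τ : G) : Finset (Finset ι) :=
  (S.powersetCard k).filter (fun T => ∑ i ∈ T, h i = τ)

omit [DecidableEq ι] in
/-- Membership in `soloBlindSeqRep`. -/
theorem soloBlind_mem_seqRep {h : ι → G} {S : Finset ι} {k : ℕ} {τ : G} {T : Finset ι} :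
    T ∈ soloBlindSeqRep h S k τ ↔ T ⊆ S ∧ T.card = k ∧ ∑ i ∈ T, h i = τ := by
  simp [soloBlindSeqRep, mem_powersetCard, and_assoc]

/-- LINK INJECTION: the size-`(k+1)` representations of `τ` through the index `u` inject, by
`T ↦ T.erase u`, into the size-`k` representations of `τ - h u` on `S.erase u`. -/
theorem soloBlind_card_link_le (h : ι → G) (S : Finset ι) (k : ℕ) (τ : G) (u : ι) :
    ((soloBlindSeqRep h S (k + 1) τ).filter (fun T => u ∈ T)).card
      ≤ (soloBlindSeqRep h (S.erase u) k (τ - h u)).card := by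
  refine Finset.card_le_card_of_injOn (fun T => T.erase u) ?_ ?_
  · intro T hT
    have hT' : T ∈ (soloBlindSeqRep h S (k + 1) τ).filter (fun T => u ∈ T) := by
      simpa using hT
    obtain ⟨hTrep, hu⟩ := Finset.mem_filter.mp hT'
    obtain ⟨hTS, hcard, hsum⟩ := soloBlind_mem_seqRep.mp hTrep
    have goal : T.erase u ∈ soloBlindSeqRep h (S.erase u) k (τ - h u) := by
      rw [soloBlind_mem_seqRep]
      refine ⟨?_, ?_, ?_⟩
      · intro x hx
        rw [Finset.mem_erase] at hx ⊢
        exact ⟨hx.1, hTS hx.2⟩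
      · rw [Finset.card_erase_of_mem hu, hcard]
        rfl
      · have hsplit : h u + ∑ i ∈ T.erase u, h i = τ := by
          rw [Finset.add_sum_erase T h hu]; exact hsum
        rw [eq_sub_iff_add_eq, add_comm]; exact hsplit
    simpa using goal
  · intro T₁ hT₁ T₂ hT₂ heq
    have hT₁' : T₁ ∈ (soloBlindSeqRep h S (k + 1) τ).filter (fun T => u ∈ T) := by simpa using hT₁
    have hT₂' : T₂ ∈ (soloBlindSeqRep h S (k + 1) τ).filter (fun T => u ∈ T) := by simpa using hT₂
    have hu₁ : u ∈ T₁ := (Finset.mem_filter.mp hT₁').2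
    have hu₂ : u ∈ T₂ := (Finset.mem_filter.mp hT₂').2
    have heq' : T₁.erase u = T₂.erase u := by simpa using heq
    rw [← Finset.insert_erase hu₁, ← Finset.insert_erase hu₂, heq']

/-- NO THREE DISJOINT REPRESENTATIONS: in exponent `3`, three pairwise disjoint non-empty... more
precisely, if `T₁` is a representation of `τ` of positive size and `T₂`, `T` are representations of `τ`
with `T₂` disjoint from `T₁`, then `T` meets `T₁ ∪ T₂` (otherwise `T ∪ T₁ ∪ T₂` is a non-empty
zero-sum). -/
theorem soloBlind_rep_meets_pair (three : ∀ g : G, g + g + g = 0) {h : ι → G} {S : Finset ι}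
    (zsf : ∀ T ⊆ S, T.Nonempty → ∑ i ∈ T, h i ≠ 0) {k : ℕ} {τ : G} {T₁ T₂ T : Finset ι}
    (hT₁ : T₁ ∈ soloBlindSeqRep h S (k + 1) τ) (hT₂ : T₂ ∈ soloBlindSeqRep h S (k + 1) τ)
    (hT : T ∈ soloBlindSeqRep h S (k + 1) τ) (hdis : Disjoint T₁ T₂) :
    (T ∩ (T₁ ∪ T₂)).Nonempty := by
  obtain ⟨h1S, h1c, h1s⟩ := soloBlind_mem_seqRep.mp hT₁
  obtain ⟨h2S, _, h2s⟩ := soloBlind_mem_seqRep.mp hT₂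
  obtain ⟨h3S, _, h3s⟩ := soloBlind_mem_seqRep.mp hT
  by_contra hcon
  rw [Finset.not_nonempty_iff_eq_empty] at hcon
  have hd : Disjoint T (T₁ ∪ T₂) := Finset.disjoint_iff_inter_eq_empty.mpr hcon
  have hsum : ∑ i ∈ T ∪ (T₁ ∪ T₂), h i = 0 := by
    rw [Finset.sum_union hd, Finset.sum_union hdis, h1s, h2s, h3s, ← add_assoc]
    exact three τ
  have hne : (T ∪ (T₁ ∪ T₂)).Nonempty := by
    have h1ne : T₁.Nonempty := Finset.card_pos.mp (by omega)
    obtain ⟨x, hx⟩ := h1ne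
    exact ⟨x, Finset.mem_union_right _ (Finset.mem_union_left _ hx)⟩
  have hsub : T ∪ (T₁ ∪ T₂) ⊆ S :=
    Finset.union_subset h3S (Finset.union_subset h1S h2S)
  exact zsf _ hsub hne hsum

/-- HITTING SET: a non-empty layer of representations of `τ` of size `k + 1` has a set `U ⊆ S` of at
most `2 (k + 1)` indices meeting every representation (one member, or two disjoint members). -/
theorem soloBlind_rep_hitting_set (three : ∀ g : G, g + g + g = 0) {h : ι → G} {S : Finset ι}
    (zsf : ∀ T ⊆ S, T.Nonempty → ∑ i ∈ T, h i ≠ 0) {k : ℕ} {τ : G} {T₁ : Finset ι}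
    (hT₁ : T₁ ∈ soloBlindSeqRep h S (k + 1) τ) :
    ∃ U : Finset ι, U.card ≤ 2 * (k + 1) ∧
      ∀ T ∈ soloBlindSeqRep h S (k + 1) τ, (T ∩ U).Nonempty := by
  obtain ⟨h1S, h1c, h1s⟩ := soloBlind_mem_seqRep.mp hT₁
  by_cases hall : ∀ T ∈ soloBlindSeqRep h S (k + 1) τ, (T ∩ T₁).Nonempty
  · exact ⟨T₁, by omega, hall⟩
  · simp only [not_forall] at hall
    obtain ⟨T₂, hT₂, hdis0⟩ := hall
    have hdis : T₂ ∩ T₁ = ∅ := Finset.not_nonempty_iff_eq_empty.mp hdis0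
    have hd : Disjoint T₁ T₂ := by
      rw [Finset.disjoint_iff_inter_eq_empty, Finset.inter_comm]; exact hdis
    obtain ⟨_, h2c, _⟩ := soloBlind_mem_seqRep.mp hT₂
    refine ⟨T₁ ∪ T₂, ?_, fun T hT => soloBlind_rep_meets_pair three zsf hT₁ hT₂ hT hd⟩
    calc (T₁ ∪ T₂).card ≤ T₁.card + T₂.card := Finset.card_union_le _ _
      _ = 2 * (k + 1) := by rw [h1c, h2c]; ring

/-- THEOREM (rank-free Erdős–Rado layer bound).  For a sequence `h` in an abelian group of exponent `3`
that is zero-sum free on `S`, every `τ` has at most `2^k · k!` representations of size `k` by indices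
in `S` — uniformly in the group, its rank and the length of the sequence. -/
theorem soloBlind_seqRep_card_le_two_pow_mul_factorial (three : ∀ g : G, g + g + g = 0)
    (h : ι → G) (S : Finset ι) (zsf : ∀ T ⊆ S, T.Nonempty → ∑ i ∈ T, h i ≠ 0) (k : ℕ) (τ : G) :
    (soloBlindSeqRep h S k τ).card ≤ 2 ^ k * k.factorial := by
  induction k generalizing S τ with
  | zero =>
    calc (soloBlindSeqRep h S 0 τ).card ≤ (S.powersetCard 0).card := Finset.card_filter_le _ _
      _ = 1 := by rw [Finset.card_powersetCard, Nat.choose_zero_right]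
      _ = 2 ^ 0 * Nat.factorial 0 := by simp
  | succ k ih =>
    by_cases hne : soloBlindSeqRep h S (k + 1) τ = ∅
    · rw [hne]; simp
    · obtain ⟨T₁, hT₁⟩ := Finset.nonempty_iff_ne_empty.mpr hne
      obtain ⟨U, hUcard, hUhit⟩ := soloBlind_rep_hitting_set three zsf hT₁
      have hcover : soloBlindSeqRep h S (k + 1) τ ⊆
          U.biUnion (fun u => (soloBlindSeqRep h S (k + 1) τ).filter (fun T => u ∈ T)) := by
        intro T hT
        obtain ⟨x, hx⟩ := hUhit T hT
        rw [Finset.mem_biUnion]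
        exact ⟨x, (Finset.mem_inter.mp hx).2, Finset.mem_filter.mpr ⟨hT, (Finset.mem_inter.mp hx).1⟩⟩
      have hlink : ∀ u ∈ U,
          ((soloBlindSeqRep h S (k + 1) τ).filter (fun T => u ∈ T)).card ≤ 2 ^ k * k.factorial := by
        intro u _
        refine (soloBlind_card_link_le h S k τ u).trans (ih (S.erase u) ?_ (τ - h u))
        intro T hT hTn
        exact zsf T (hT.trans (Finset.erase_subset u S)) hTn
      calc (soloBlindSeqRep h S (k + 1) τ).card
          ≤ (U.biUnion (fun u => (soloBlindSeqRep h S (k + 1) τ).filter (fun T => u ∈ T))).card :=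
            Finset.card_le_card hcover
        _ ≤ ∑ u ∈ U, ((soloBlindSeqRep h S (k + 1) τ).filter (fun T => u ∈ T)).card :=
            Finset.card_biUnion_le
        _ ≤ ∑ u ∈ U, 2 ^ k * k.factorial := Finset.sum_le_sum hlink
        _ = U.card * (2 ^ k * k.factorial) := by rw [Finset.sum_const, smul_eq_mul]
        _ ≤ (2 * (k + 1)) * (2 ^ k * k.factorial) := Nat.mul_le_mul_right _ hUcard
        _ = 2 ^ (k + 1) * (k + 1).factorial := by rw [Nat.factorial_succ, pow_succ]; ring

/-- The same bound over `𝔽₃^r` (`G = Fin r → ZMod 3`), the case of door I1⁗: for every zero-sum-free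
sequence over `𝔽₃^r`, of any rank and length, `N_k(τ) ≤ 2^k · k!`. -/
theorem soloBlind_seqRep_card_le_F3 {r : ℕ} (h : ι → (Fin r → ZMod 3)) (S : Finset ι)
    (zsf : ∀ T ⊆ S, T.Nonempty → ∑ i ∈ T, h i ≠ 0) (k : ℕ) (τ : Fin r → ZMod 3) :
    (soloBlindSeqRep h S k τ).card ≤ 2 ^ k * k.factorial := by
  refine soloBlind_seqRep_card_le_two_pow_mul_factorial ?_ h S zsf k τ
  intro g
  funext i
  have h3 : ∀ a : ZMod 3, a + a + a = 0 := by decide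
  exact h3 (g i)

end Summit.MatrixMultiplication.MatrixMultiplication.Theorems
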